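import Summits.CriticalPhenomena.PercolationContinuityZ3.Theorems.PercNearOneGluingAdditiveGluingKnThm2GoodAux
import Summits.CriticalPhenomena.PercolationContinuityZ3.Theorems.PercNearOneGluingAdditiveGluingKnThm2GoodEvents
import Summits.CriticalPhenomena.PercolationContinuityZ3.Theorems.PercNearOneGluingAdditiveGluingBhkSets
import Summits.CriticalPhenomena.PercolationContinuityZ3.Theorems.PercNearOneGluingAdditiveGluingBystanderThm2
import Literature.Probability.Percolation.KozmaNitzanPreFKG
import HarnessLib

/-! # Crux `PercNearOneGluing.AdditiveGluing` (stmt-CriticalPhenomena-4576): three relays —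
# the bad-region excess lives in the all-separated world (`δ ≤ μ(M ∩ a₃↔b)`)

Support file (`--supports stmt-CriticalPhenomena-4576`, lead prim-png-lead-4576, line `starglue` v10), toward the
registered stubs `stub_threeRelaysDefectBound_pl` (K3a) / `stub_regionCertThreeRelays_d2` (T1).  No definitions, no
named facts, no sorries.

Notation (as in `…ThreeRelaysRegion`, `…ThreeRelaysDefect`): `N₁₂ = {a₁↮a₃} ∩ {a₂↮a₃}`, `m₃ = μ(N₁₂ ∩ a₃↔b)`,
`m₁₂ = μ(N₁₂ ∩ a₁↔b ∩ a₂↔b)`, `δ = m₃ − m₁₂` (the bad-region excess), `M = N₁₂ ∩ {a₁↮a₂}` (all three relays separated).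

**Lemma (this file, `threeRelays_delta_le_mWorld`).**  If `a₃` is not better connected to `b` than `a₁` (`τ₃ ≤ τ₁`), then
`m₃ − m₁₂ ≤ μ(M ∩ a₃↔b) = μ(N₁₂ ∩ {a₁↮a₂} ∩ a₃↔b)`: the whole bad-region excess `δ` is carried by configurations in which
the three relays are pairwise separated.  Equivalently, in the "glued pair" world `G₁₂ = N₁₂ ∩ {a₁↔a₂}` the target prefers
the pair: `μ(G₁₂ ∩ a₃↔b) ≤ μ(G₁₂ ∩ a₁↔b ∩ a₂↔b)` (`threeRelays_glued_pair_prefers_pair`).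
Proof: van den Berg–Häggström–Kahn for the clusters of `S = {a₁,a₂}` and `S' = {a₃}` (both forms, hypotheses `hB1`,
`hB2` = the landed `stub_bhkSets`, through the landed wrappers `knThm2_bhkOne/Two` with the increasing functions
`1{A' ↔ b}` and `1{a₁ ↔ a₂} = 1{∀ s ∈ S, s ↔ a₂}`) and the Kozma–Nitzan exchange `μ(N₁₂ ∩ a₃↔b) ≤ μ(N₁₂ ∩ a₁↔b)`
(`KozmaNitzan2024_lemma3_ii_notConn`):  `P₁₂·X ≤ μ(N₁₂∩a₁a₂)·m₃ ≤ μ(N₁₂∩a₁a₂)·μ(N₁₂∩A'b) ≤ P₁₂·m₁₂` with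
`X = μ(G₁₂ ∩ a₃↔b)`.
Role: with `ε = φ₁₂−φ₁−φ₂` this sharpens (K3a) `ε·δ ≤ D` to the M-world statement `ε·μ(M ∩ a₃↔b) ≤ D` (numerically
`≤ 0.33·D_M` on the region, lead's exact engine; LeadMath-prim.md).
[cite: VandenbergHaggstromKahn2005, Thms. 1.3–1.4; KozmaNitzan2024, Lemma 3(ii) (p. 6), Theorem 2 (pp. 8–9)]
-/

namespace Summit.CriticalPhenomena.PercolationContinuityZ3.Theorems

open MeasureTheory Set Literature.Probability.LatticeModels Literature.Probability.Percolation

noncomputable section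
open Classical

variable {n : ℕ}

/-- On `{a₁ ↔ a₂}` the events `{a₁↔b} ∪ {a₂↔b}` and `{a₁↔b} ∩ {a₂↔b}` coincide:
`({a₁↔b} ∪ {a₂↔b}) ∩ {a₁↔a₂} = N-free identity`. [folklore] -/
theorem threeRelays_union_inter_glued (b a₁ a₂ : Fin n) :
    ((openConn a₁ b ∪ openConn a₂ b) ∩ openConn a₁ a₂ : Set (BondConfig (Fin n))) =
      openConn a₁ b ∩ openConn a₂ b := by
  ext ω
  simp only [Set.mem_inter_iff, Set.mem_union, knThm2_mem_openConn]
  constructor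
  · rintro ⟨h | h, h12⟩
    · exact ⟨h, h12.symm.trans h⟩
    · exact ⟨h12.trans h, h⟩
  · rintro ⟨h1, h2⟩
    exact ⟨Or.inl h1, h1.trans h2.symm⟩

/-- **BHK, first form, for the glued pair**: with `N₁₂ = {A' ↮ a₃}`, `A' = {a₁,a₂}`,
`μ(N₁₂ ∩ A'↔b)·μ(N₁₂ ∩ a₁↔a₂) ≤ μ(N₁₂)·μ(N₁₂ ∩ a₁↔b ∩ a₂↔b)` (`f = 1{A'↔b}`, `g = 1{a₁↔a₂}`, both increasing
functions of the cluster of `A'`). [cite: VandenbergHaggstromKahn2005, Thm. 1.3 (p. 6)] -/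
theorem threeRelays_glue_bhk1
    (hB1 : ∀ (n : ℕ) (w : Sym2 (Fin n) → unitInterval) (S : Finset (Fin n)) (X : Set (Fin n))
        (F G : Set (Sym2 (Fin n)) → ℝ), Monotone F → Monotone G → (∀ s ∈ S, s ∉ X) →
        (∫ ω in {ω : BondConfig (Fin n) | ∀ s ∈ S, ∀ x ∈ X, ¬ (openGraph ω).Reachable s x},
            F (⋃ s ∈ S, openEdgeCluster ω s) ∂(prodBernoulli w)) *
          (∫ ω in {ω : BondConfig (Fin n) | ∀ s ∈ S, ∀ x ∈ X, ¬ (openGraph ω).Reachable s x},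
            G (⋃ s ∈ S, openEdgeCluster ω s) ∂(prodBernoulli w)) ≤
        (prodBernoulli w).real
            {ω : BondConfig (Fin n) | ∀ s ∈ S, ∀ x ∈ X, ¬ (openGraph ω).Reachable s x} *
          ∫ ω in {ω : BondConfig (Fin n) | ∀ s ∈ S, ∀ x ∈ X, ¬ (openGraph ω).Reachable s x},
            F (⋃ s ∈ S, openEdgeCluster ω s) * G (⋃ s ∈ S, openEdgeCluster ω s)
              ∂(prodBernoulli w))
    (w : Sym2 (Fin n) → unitInterval) (b a₁ a₂ a₃ : Fin n) (h13 : a₁ ≠ a₃) (h23 : a₂ ≠ a₃) :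
    (prodBernoulli w).real ((openConn a₁ a₃)ᶜ ∩ (openConn a₂ a₃)ᶜ ∩ (openConn a₁ b ∪ openConn a₂ b)) *
        (prodBernoulli w).real ((openConn a₁ a₃)ᶜ ∩ (openConn a₂ a₃)ᶜ ∩ openConn a₁ a₂) ≤
      (prodBernoulli w).real ((openConn a₁ a₃)ᶜ ∩ (openConn a₂ a₃)ᶜ : Set (BondConfig (Fin n))) *
        (prodBernoulli w).real ((openConn a₁ a₃)ᶜ ∩ (openConn a₂ a₃)ᶜ ∩ (openConn a₁ b ∩ openConn a₂ b)) := by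
  have i1 := knThm2_bhkOne hB1 w {a₁, a₂} ({a₃} : Set (Fin n)) b a₂ (by simp [h13, h23])
  rw [knThm2_sep_pair_set, Finset.set_biUnion_insert, Finset.set_biUnion_singleton,
    Finset.set_biInter_insert, Finset.set_biInter_singleton, v1362_openConn_self, Set.inter_univ,
    threeRelays_union_inter_glued] at i1
  exact i1

/-- **BHK, second form, for the glued pair against `a₃`**: `μ(N₁₂)·μ(N₁₂ ∩ a₃↔b ∩ a₁↔a₂) ≤ μ(N₁₂ ∩ a₃↔b)·μ(N₁₂ ∩ a₁↔a₂)`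
(`f = 1{a₃↔b}` on the cluster of `a₃`, `g = 1{a₁↔a₂}` on the cluster of `A'`).
[cite: VandenbergHaggstromKahn2005, Thm. 1.4 (p. 7)] -/
theorem threeRelays_glue_bhk2
    (hB2 : ∀ (n : ℕ) (w : Sym2 (Fin n) → unitInterval) (S S' : Finset (Fin n))
        (F G : Set (Sym2 (Fin n)) → ℝ), Monotone F → Monotone G → Disjoint S S' →
        (prodBernoulli w).real
            {ω : BondConfig (Fin n) | ∀ s ∈ S, ∀ x ∈ S', ¬ (openGraph ω).Reachable s x} *
          (∫ ω in {ω : BondConfig (Fin n) | ∀ s ∈ S, ∀ x ∈ S', ¬ (openGraph ω).Reachable s x},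
            F (⋃ s ∈ S, openEdgeCluster ω s) * G (⋃ s ∈ S', openEdgeCluster ω s)
              ∂(prodBernoulli w)) ≤
        (∫ ω in {ω : BondConfig (Fin n) | ∀ s ∈ S, ∀ x ∈ S', ¬ (openGraph ω).Reachable s x},
            F (⋃ s ∈ S, openEdgeCluster ω s) ∂(prodBernoulli w)) *
          (∫ ω in {ω : BondConfig (Fin n) | ∀ s ∈ S, ∀ x ∈ S', ¬ (openGraph ω).Reachable s x},
            G (⋃ s ∈ S', openEdgeCluster ω s) ∂(prodBernoulli w)))
    (w : Sym2 (Fin n) → unitInterval) (b a₁ a₂ a₃ : Fin n) (h13 : a₁ ≠ a₃) (h23 : a₂ ≠ a₃) :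
    (prodBernoulli w).real ((openConn a₁ a₃)ᶜ ∩ (openConn a₂ a₃)ᶜ : Set (BondConfig (Fin n))) *
        (prodBernoulli w).real ((openConn a₁ a₃)ᶜ ∩ (openConn a₂ a₃)ᶜ ∩ (openConn a₃ b ∩ openConn a₁ a₂)) ≤
      (prodBernoulli w).real ((openConn a₁ a₃)ᶜ ∩ (openConn a₂ a₃)ᶜ ∩ openConn a₃ b) *
        (prodBernoulli w).real ((openConn a₁ a₃)ᶜ ∩ (openConn a₂ a₃)ᶜ ∩ openConn a₁ a₂) := by
  have i2 := knThm2_bhkTwo hB2 w {a₃} {a₁, a₂} b a₂ (by simp [h13.symm, h23.symm])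
  rw [knThm2_sep_single_finset, Finset.set_biUnion_singleton, Finset.set_biInter_insert,
    Finset.set_biInter_singleton, v1362_openConn_self, Set.inter_univ,
    knThm2_openConn_comm a₃ a₁, knThm2_openConn_comm a₃ a₂] at i2
  exact i2

/-- **Exchange on `N₁₂`** (Kozma–Nitzan Lemma 3(ii) with the decreasing event `{a₃ ↮ a₁, a₃ ↮ a₂}` of the cluster of
`a₃`): if `τ₃ ≤ τ₁` then `μ(N₁₂ ∩ a₃↔b) ≤ μ(N₁₂ ∩ ({a₁↔b} ∪ {a₂↔b}))`. [cite: KozmaNitzan2024, Lemma 3(ii) (p. 6)] -/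
theorem threeRelays_exchange_N12 (w : Sym2 (Fin n) → unitInterval) (b a₁ a₂ a₃ : Fin n)
    (h31 : (prodBernoulli w).real (openConn a₃ b) ≤ (prodBernoulli w).real (openConn a₁ b)) :
    (prodBernoulli w).real ((openConn a₁ a₃)ᶜ ∩ (openConn a₂ a₃)ᶜ ∩ openConn a₃ b) ≤
      (prodBernoulli w).real ((openConn a₁ a₃)ᶜ ∩ (openConn a₂ a₃)ᶜ ∩ (openConn a₁ b ∪ openConn a₂ b)) := by
  have key := KozmaNitzan2024_lemma3_ii_notConn w a₃ a₁ b ({a₁, a₂} : Set (Fin n)) h31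
  have hQ : ({ω : BondConfig (Fin n) | ∀ u ∈ ({a₁, a₂} : Set (Fin n)), ¬ (openGraph ω).Reachable a₃ u}) =
      (openConn a₁ a₃)ᶜ ∩ (openConn a₂ a₃)ᶜ := by
    ext ω
    simp only [Set.mem_insert_iff, Set.mem_singleton_iff, forall_eq_or_imp, forall_eq, Set.mem_setOf_eq,
      Set.mem_inter_iff, Set.mem_compl_iff, knThm2_mem_openConn]
    exact ⟨fun ⟨h1, h2⟩ => ⟨fun h => h1 h.symm, fun h => h2 h.symm⟩,
      fun ⟨h1, h2⟩ => ⟨fun h => h1 h.symm, fun h => h2 h.symm⟩⟩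
  rw [hQ, Set.inter_comm (openConn a₃ b), Set.inter_comm (openConn a₁ b)] at key
  exact key.trans (measureReal_mono (Set.inter_subset_inter_right _ Set.subset_union_left) (measure_ne_top _ _))

/-- **In the glued-pair world the target prefers the pair**: with `G₁₂ = N₁₂ ∩ {a₁↔a₂}` and `τ₃ ≤ τ₁`,
`μ(G₁₂ ∩ a₃↔b) ≤ μ(G₁₂ ∩ a₁↔b ∩ a₂↔b)`.  Proof: `P₁₂·μ(G₁₂∩a₃b) ≤ μ(N₁₂∩a₁a₂)·μ(N₁₂∩a₃b)` (BHK 2nd form)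
`≤ μ(N₁₂∩a₁a₂)·μ(N₁₂∩A'b)` (exchange) `≤ P₁₂·μ(N₁₂∩a₁b∩a₂b)` (BHK 1st form).
[cite: VandenbergHaggstromKahn2005, Thms. 1.3–1.4; KozmaNitzan2024, Lemma 3(ii)] -/
theorem threeRelays_glued_pair_prefers_pair
    (hB1 : ∀ (n : ℕ) (w : Sym2 (Fin n) → unitInterval) (S : Finset (Fin n)) (X : Set (Fin n))
        (F G : Set (Sym2 (Fin n)) → ℝ), Monotone F → Monotone G → (∀ s ∈ S, s ∉ X) →
        (∫ ω in {ω : BondConfig (Fin n) | ∀ s ∈ S, ∀ x ∈ X, ¬ (openGraph ω).Reachable s x},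
            F (⋃ s ∈ S, openEdgeCluster ω s) ∂(prodBernoulli w)) *
          (∫ ω in {ω : BondConfig (Fin n) | ∀ s ∈ S, ∀ x ∈ X, ¬ (openGraph ω).Reachable s x},
            G (⋃ s ∈ S, openEdgeCluster ω s) ∂(prodBernoulli w)) ≤
        (prodBernoulli w).real
            {ω : BondConfig (Fin n) | ∀ s ∈ S, ∀ x ∈ X, ¬ (openGraph ω).Reachable s x} *
          ∫ ω in {ω : BondConfig (Fin n) | ∀ s ∈ S, ∀ x ∈ X, ¬ (openGraph ω).Reachable s x},
            F (⋃ s ∈ S, openEdgeCluster ω s) * G (⋃ s ∈ S, openEdgeCluster ω s)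
              ∂(prodBernoulli w))
    (hB2 : ∀ (n : ℕ) (w : Sym2 (Fin n) → unitInterval) (S S' : Finset (Fin n))
        (F G : Set (Sym2 (Fin n)) → ℝ), Monotone F → Monotone G → Disjoint S S' →
        (prodBernoulli w).real
            {ω : BondConfig (Fin n) | ∀ s ∈ S, ∀ x ∈ S', ¬ (openGraph ω).Reachable s x} *
          (∫ ω in {ω : BondConfig (Fin n) | ∀ s ∈ S, ∀ x ∈ S', ¬ (openGraph ω).Reachable s x},
            F (⋃ s ∈ S, openEdgeCluster ω s) * G (⋃ s ∈ S', openEdgeCluster ω s)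
              ∂(prodBernoulli w)) ≤
        (∫ ω in {ω : BondConfig (Fin n) | ∀ s ∈ S, ∀ x ∈ S', ¬ (openGraph ω).Reachable s x},
            F (⋃ s ∈ S, openEdgeCluster ω s) ∂(prodBernoulli w)) *
          (∫ ω in {ω : BondConfig (Fin n) | ∀ s ∈ S, ∀ x ∈ S', ¬ (openGraph ω).Reachable s x},
            G (⋃ s ∈ S', openEdgeCluster ω s) ∂(prodBernoulli w)))
    (w : Sym2 (Fin n) → unitInterval) (b a₁ a₂ a₃ : Fin n) (h13 : a₁ ≠ a₃) (h23 : a₂ ≠ a₃)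
    (h31 : (prodBernoulli w).real (openConn a₃ b) ≤ (prodBernoulli w).real (openConn a₁ b)) :
    (prodBernoulli w).real ((openConn a₁ a₃)ᶜ ∩ (openConn a₂ a₃)ᶜ ∩ (openConn a₃ b ∩ openConn a₁ a₂)) ≤
      (prodBernoulli w).real ((openConn a₁ a₃)ᶜ ∩ (openConn a₂ a₃)ᶜ ∩ (openConn a₁ b ∩ openConn a₂ b)) := by
  have j1 := threeRelays_glue_bhk1 hB1 w b a₁ a₂ a₃ h13 h23
  have j2 := threeRelays_glue_bhk2 hB2 w b a₁ a₂ a₃ h13 h23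
  have j3 := threeRelays_exchange_N12 w b a₁ a₂ a₃ h31
  set P := (prodBernoulli w).real ((openConn a₁ a₃)ᶜ ∩ (openConn a₂ a₃)ᶜ : Set (BondConfig (Fin n))) with hP
  set G := (prodBernoulli w).real ((openConn a₁ a₃)ᶜ ∩ (openConn a₂ a₃)ᶜ ∩ openConn a₁ a₂)
  set X := (prodBernoulli w).real ((openConn a₁ a₃)ᶜ ∩ (openConn a₂ a₃)ᶜ ∩ (openConn a₃ b ∩ openConn a₁ a₂))
  set Y := (prodBernoulli w).real ((openConn a₁ a₃)ᶜ ∩ (openConn a₂ a₃)ᶜ ∩ (openConn a₁ b ∩ openConn a₂ b))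
  set M3 := (prodBernoulli w).real ((openConn a₁ a₃)ᶜ ∩ (openConn a₂ a₃)ᶜ ∩ openConn a₃ b)
  set M12 := (prodBernoulli w).real ((openConn a₁ a₃)ᶜ ∩ (openConn a₂ a₃)ᶜ ∩ (openConn a₁ b ∪ openConn a₂ b))
  have hG : 0 ≤ G := measureReal_nonneg
  have hXP : X ≤ P := measureReal_mono Set.inter_subset_left (measure_ne_top _ _)
  have hY : 0 ≤ Y := measureReal_nonneg
  -- chain: P·X ≤ M3·G ≤ M12·G ≤ P·Y
  have hc : P * X ≤ P * Y := by
    calc P * X ≤ M3 * G := j2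
      _ ≤ M12 * G := mul_le_mul_of_nonneg_right j3 hG
      _ ≤ P * Y := j1
  rcases eq_or_lt_of_le (measureReal_nonneg : 0 ≤ P) with hP0 | hPpos
  · -- degenerate: μ(N₁₂) = 0
    linarith
  · exact le_of_mul_le_mul_left hc hPpos

/-- **The bad-region excess lives in the all-separated world** (conditional on the set-BHK inequalities `hB1`, `hB2`):
if `τ₃ ≤ τ₁` then `m₃ − m₁₂ ≤ μ(N₁₂ ∩ {a₁ ↮ a₂} ∩ a₃↔b)` (`= μ(M ∩ a₃↔b)`).
[cite: KozmaNitzan2024, Theorem 2 (pp. 8–9); VandenbergHaggstromKahn2005, Thms. 1.3–1.4] -/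
theorem threeRelays_delta_le_mWorld_of_bhk
    (hB1 : ∀ (n : ℕ) (w : Sym2 (Fin n) → unitInterval) (S : Finset (Fin n)) (X : Set (Fin n))
        (F G : Set (Sym2 (Fin n)) → ℝ), Monotone F → Monotone G → (∀ s ∈ S, s ∉ X) →
        (∫ ω in {ω : BondConfig (Fin n) | ∀ s ∈ S, ∀ x ∈ X, ¬ (openGraph ω).Reachable s x},
            F (⋃ s ∈ S, openEdgeCluster ω s) ∂(prodBernoulli w)) *
          (∫ ω in {ω : BondConfig (Fin n) | ∀ s ∈ S, ∀ x ∈ X, ¬ (openGraph ω).Reachable s x},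
            G (⋃ s ∈ S, openEdgeCluster ω s) ∂(prodBernoulli w)) ≤
        (prodBernoulli w).real
            {ω : BondConfig (Fin n) | ∀ s ∈ S, ∀ x ∈ X, ¬ (openGraph ω).Reachable s x} *
          ∫ ω in {ω : BondConfig (Fin n) | ∀ s ∈ S, ∀ x ∈ X, ¬ (openGraph ω).Reachable s x},
            F (⋃ s ∈ S, openEdgeCluster ω s) * G (⋃ s ∈ S, openEdgeCluster ω s)
              ∂(prodBernoulli w))
    (hB2 : ∀ (n : ℕ) (w : Sym2 (Fin n) → unitInterval) (S S' : Finset (Fin n))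
        (F G : Set (Sym2 (Fin n)) → ℝ), Monotone F → Monotone G → Disjoint S S' →
        (prodBernoulli w).real
            {ω : BondConfig (Fin n) | ∀ s ∈ S, ∀ x ∈ S', ¬ (openGraph ω).Reachable s x} *
          (∫ ω in {ω : BondConfig (Fin n) | ∀ s ∈ S, ∀ x ∈ S', ¬ (openGraph ω).Reachable s x},
            F (⋃ s ∈ S, openEdgeCluster ω s) * G (⋃ s ∈ S', openEdgeCluster ω s)
              ∂(prodBernoulli w)) ≤
        (∫ ω in {ω : BondConfig (Fin n) | ∀ s ∈ S, ∀ x ∈ S', ¬ (openGraph ω).Reachable s x},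
            F (⋃ s ∈ S, openEdgeCluster ω s) ∂(prodBernoulli w)) *
          (∫ ω in {ω : BondConfig (Fin n) | ∀ s ∈ S, ∀ x ∈ S', ¬ (openGraph ω).Reachable s x},
            G (⋃ s ∈ S', openEdgeCluster ω s) ∂(prodBernoulli w)))
    (w : Sym2 (Fin n) → unitInterval) (b a₁ a₂ a₃ : Fin n) (h13 : a₁ ≠ a₃) (h23 : a₂ ≠ a₃)
    (h31 : (prodBernoulli w).real (openConn a₃ b) ≤ (prodBernoulli w).real (openConn a₁ b)) :
    (prodBernoulli w).real ((openConn a₁ a₃)ᶜ ∩ (openConn a₂ a₃)ᶜ ∩ openConn a₃ b) -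
        (prodBernoulli w).real ((openConn a₁ a₃)ᶜ ∩ (openConn a₂ a₃)ᶜ ∩ (openConn a₁ b ∩ openConn a₂ b)) ≤
      (prodBernoulli w).real ((openConn a₁ a₃)ᶜ ∩ (openConn a₂ a₃)ᶜ ∩ (openConn a₁ a₂)ᶜ ∩ openConn a₃ b) := by
  have hm : ∀ s : Set (BondConfig (Fin n)), MeasurableSet s := fun _ => MeasurableSet.of_discrete
  have hsplit := measureReal_inter_add_sdiff (μ := prodBernoulli w)
    (s := (openConn a₁ a₃)ᶜ ∩ (openConn a₂ a₃)ᶜ ∩ openConn a₃ b) (hm (openConn a₁ a₂))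
  have e1 : ((openConn a₁ a₃)ᶜ ∩ (openConn a₂ a₃)ᶜ ∩ openConn a₃ b ∩ openConn a₁ a₂ : Set (BondConfig (Fin n))) =
      (openConn a₁ a₃)ᶜ ∩ (openConn a₂ a₃)ᶜ ∩ (openConn a₃ b ∩ openConn a₁ a₂) := by
    rw [Set.inter_assoc]
  have e2 : (((openConn a₁ a₃)ᶜ ∩ (openConn a₂ a₃)ᶜ ∩ openConn a₃ b) \ openConn a₁ a₂ : Set (BondConfig (Fin n))) =
      (openConn a₁ a₃)ᶜ ∩ (openConn a₂ a₃)ᶜ ∩ (openConn a₁ a₂)ᶜ ∩ openConn a₃ b := by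
    rw [Set.sdiff_eq, Set.inter_assoc, Set.inter_comm (openConn a₃ b), ← Set.inter_assoc]
  rw [e1, e2] at hsplit
  have hX := threeRelays_glued_pair_prefers_pair hB1 hB2 w b a₁ a₂ a₃ h13 h23 h31
  linarith

/-- **The bad-region excess lives in the all-separated world** (unconditional: the set-BHK inequalities are the landed
`stub_bhkSets`): for three relays with `a₃ ≠ a₁, a₂` and `τ₃ ≤ τ₁`,
`μ(N₁₂ ∩ a₃↔b) − μ(N₁₂ ∩ a₁↔b ∩ a₂↔b) ≤ μ(N₁₂ ∩ {a₁↮a₂} ∩ a₃↔b)`, i.e. `δ = m₃ − m₁₂ ≤ μ(M ∩ a₃↔b)`.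
[cite: KozmaNitzan2024, Theorem 2 (pp. 8–9); VandenbergHaggstromKahn2005, Thms. 1.3–1.4] -/
theorem threeRelays_delta_le_mWorld (w : Sym2 (Fin n) → unitInterval) (b a₁ a₂ a₃ : Fin n)
    (h13 : a₁ ≠ a₃) (h23 : a₂ ≠ a₃)
    (h31 : (prodBernoulli w).real (openConn a₃ b) ≤ (prodBernoulli w).real (openConn a₁ b)) :
    (prodBernoulli w).real ((openConn a₁ a₃)ᶜ ∩ (openConn a₂ a₃)ᶜ ∩ openConn a₃ b) -
        (prodBernoulli w).real ((openConn a₁ a₃)ᶜ ∩ (openConn a₂ a₃)ᶜ ∩ (openConn a₁ b ∩ openConn a₂ b)) ≤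
      (prodBernoulli w).real ((openConn a₁ a₃)ᶜ ∩ (openConn a₂ a₃)ᶜ ∩ (openConn a₁ a₂)ᶜ ∩ openConn a₃ b) :=
  threeRelays_delta_le_mWorld_of_bhk stub_bhkSets.1 stub_bhkSets.2 w b a₁ a₂ a₃ h13 h23 h31

end

end Summit.CriticalPhenomena.PercolationContinuityZ3.Theorems
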